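import Mathlib
import Summits.Ventures.PercRepro2.CutVertexDefs
import Summits.Ventures.PercRepro2.A3PendantFreeLeaf

/-!
# The a₃-exploration fibres across a cut vertex: the fibres of the cut vertex factor into an
`A`-side and a `B`-side fibre
(blind cell PercRepro2, night-1 g32; proofs/NIGHT1-G32.md §5; the sums are A3CutSums.lean)

Let `x` be a cut vertex (`CutV.IsCut ends x ↑VA ↑VB EA EB`, `VA VB : Finset V`) with the four marks on
the `B`-side.  The cluster of `x` is the union of its two side clusters (`cluster_x_eq_union`), so the
fibre of the `x`-exploration at `W = S ∪ T` (`S ⊆ VA`, `x ∈ T ⊆ VB ∪ {x}`) is the product of the `A`-side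
cluster event `{C_A(x) = insert x S}` and the `B`-side event `{C_B(x) = T} ∩ Q ∩ (mark event)`
(`fibre_x_eq`), and its probability factors (`prob_fibre_x_inter_eq_mul`); every other fibre is empty.
Sums over all `W` are sums over the pairs `(S, T)` (`sum_eq_sum_pairs`), and the `A`-side cluster events
`{C_A(x) = insert x S}`, `S ⊆ VA`, partition every `A`-side event (`sum_prob_sideA_cluster_inter`).
Standard axioms.
-/

namespace Summit.Ventures.PercRepro2

open UnionCluster CovForm CutV

namespace CovForm

namespace A3Fibre

/-! ## Reindexing a sum over finsets by the two intersections -/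

section Pairs

variable {V : Type*} [Fintype V] [DecidableEq V] {R : Type*} [AddCommMonoid R]

/-- A finset inside `A ∪ B` (disjoint) is the union of its two intersections, and the pair is unique. -/
lemma sum_eq_sum_pairs (A B : Finset V) (hAB : Disjoint A B) (f : Finset V → R)
    (hf : ∀ W, ¬ W ⊆ A ∪ B → f W = 0) :
    ∑ W, f W = ∑ S ∈ A.powerset, ∑ T ∈ B.powerset, f (S ∪ T) := by
  rw [← Finset.sum_product' A.powerset B.powerset (fun S T => f (S ∪ T))]
  have hinj : Set.InjOn (fun q : Finset V × Finset V => q.1 ∪ q.2) ↑(A.powerset ×ˢ B.powerset) := by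
    rintro ⟨S, T⟩ hST ⟨S', T'⟩ hST' heq
    simp only [Finset.coe_product, Set.mem_prod, Finset.mem_coe, Finset.mem_powerset] at hST hST'
    simp only at heq
    have h1 : S = S' := by
      ext u
      constructor
      · intro hu
        have : u ∈ S' ∪ T' := heq ▸ Finset.mem_union_left T hu
        rcases Finset.mem_union.1 this with h | h
        · exact h
        · exact absurd (hST'.2 h) (Finset.disjoint_left.1 hAB (hST.1 hu))
      · intro hu
        have : u ∈ S ∪ T := heq.symm ▸ Finset.mem_union_left T' hu
        rcases Finset.mem_union.1 this with h | h
        · exact h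
        · exact absurd (hST.2 h) (Finset.disjoint_left.1 hAB (hST'.1 hu))
    have h2 : T = T' := by
      ext u
      constructor
      · intro hu
        have : u ∈ S' ∪ T' := heq ▸ Finset.mem_union_right S hu
        rcases Finset.mem_union.1 this with h | h
        · exact absurd (hST.2 hu) (Finset.disjoint_left.1 hAB (hST'.1 h))
        · exact h
      · intro hu
        have : u ∈ S ∪ T := heq.symm ▸ Finset.mem_union_right S' hu
        rcases Finset.mem_union.1 this with h | h
        · exact absurd (hST'.2 hu) (Finset.disjoint_left.1 hAB (hST.1 h))
        · exact h
    rw [h1, h2]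
  rw [← Finset.sum_image hinj]
  symm
  apply Finset.sum_subset (Finset.subset_univ _)
  intro W _ hW
  apply hf
  intro hsub
  apply hW
  rw [Finset.mem_image]
  refine ⟨(W ∩ A, W ∩ B), ?_, ?_⟩
  · rw [Finset.mem_product, Finset.mem_powerset, Finset.mem_powerset]
    exact ⟨Finset.inter_subset_right, Finset.inter_subset_right⟩
  · simp only
    rw [← Finset.inter_union_distrib_left]
    exact Finset.inter_eq_left.2 hsub

end Pairs

/-! ## The cluster of the cut vertex -/

section CutVertex

variable {V : Type*} {E : Type*} [Fintype V] [DecidableEq V] [Fintype E] [DecidableEq E]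
  {ends : E → Sym2 V} {x : V} {VA VB : Finset V} {EA EB : Set E} [DecidablePred (· ∈ EA)]
  [DecidablePred (· ∈ EB)]

omit [Fintype V] [DecidableEq V] [Fintype E] [DecidableEq E] in
/-- The cluster of the cut vertex is the union of its two side clusters. -/
lemma cluster_x_eq_union (h : IsCut ends x ↑VA ↑VB EA EB) (ω : Config E) :
    cluster ends ω x = cluster ends (restrict EA ω) x ∪ cluster ends (restrict EB ω) x := by
  ext u
  constructor
  · intro hu
    rcases mem_union_of_conn h (Or.inr rfl) hu with (huA | huB) | hux
    · exact Or.inl ((conn_iff_restrict h (Or.inr rfl) (Or.inl huA)).mp hu)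
    · exact Or.inr ((conn_iff_restrict h.symm (Or.inr rfl) (Or.inl huB)).mp hu)
    · exact Or.inl ((conn_iff_restrict h (Or.inr rfl) (Or.inr hux)).mp hu)
  · rintro (hu | hu)
    · exact conn_mono (restrict_le EA ω) hu
    · exact conn_mono (restrict_le EB ω) hu

omit [Fintype V] [DecidableEq V] [Fintype E] [DecidableEq E] [DecidablePred (· ∈ EA)]
  [DecidablePred (· ∈ EB)] in
/-- `x ∈ C(x)`, and `C(x) ⊆ VA ∪ VB ∪ {x}`. -/
lemma cluster_x_subset (h : IsCut ends x ↑VA ↑VB EA EB) (ω : Config E) :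
    cluster ends ω x ⊆ ↑VA ∪ ↑VB ∪ {x} := fun _ hu => mem_union_of_conn h (Or.inr rfl) hu

omit [Fintype V] [Fintype E] [DecidableEq E] [DecidablePred (· ∈ EB)] in
/-- The `A`-side cluster of `x` is `insert x S` for `S = C_A(x) \ {x} ⊆ VA`. -/
lemma clusterA_x_eq (h : IsCut ends x ↑VA ↑VB EA EB) {ω : Config E} {S : Finset V} (hS : S ⊆ VA)
    {T : Finset V} (hT : T ⊆ insert x VB) (hxT : x ∈ T)
    (hW : cluster ends ω x = ↑(S ∪ T)) :
    cluster ends (restrict EA ω) x = ↑(insert x S) := by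
  rw [← cluster_inter_eq h (Or.inr rfl), hW]
  ext u
  simp only [Finset.coe_union, Set.mem_inter_iff, Set.mem_union, Finset.mem_coe, Set.mem_singleton_iff,
    Finset.coe_insert, Set.mem_insert_iff]
  constructor
  · rintro ⟨hu | hu, huA | hux⟩
    · exact Or.inr hu
    · exact Or.inl hux
    · exfalso
      rcases Finset.mem_insert.1 (hT hu) with rfl | huB
      · exact h.x_notA huA
      · exact Finset.disjoint_left.1 (Finset.disjoint_coe.1 h.disj) huA huB
    · exact Or.inl hux
  · rintro (rfl | hu)
    · exact ⟨Or.inr hxT, Or.inr rfl⟩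
    · exact ⟨Or.inl hu, Or.inl (hS hu)⟩

omit [Fintype V] [Fintype E] [DecidableEq E] [DecidablePred (· ∈ EA)] in
/-- The `B`-side cluster of `x` is `T`. -/
lemma clusterB_x_eq (h : IsCut ends x ↑VA ↑VB EA EB) {ω : Config E} {S : Finset V} (hS : S ⊆ VA)
    {T : Finset V} (hT : T ⊆ insert x VB) (hxT : x ∈ T)
    (hW : cluster ends ω x = ↑(S ∪ T)) :
    cluster ends (restrict EB ω) x = ↑T := by
  rw [← cluster_inter_eq h.symm (Or.inr rfl), hW]
  ext u
  simp only [Finset.coe_union, Set.mem_inter_iff, Set.mem_union, Finset.mem_coe, Set.mem_singleton_iff]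
  constructor
  · rintro ⟨hu | hu, huB | hux⟩
    · exact absurd huB (Finset.disjoint_left.1 (Finset.disjoint_coe.1 h.disj) (hS hu))
    · exfalso
      exact h.x_notA (hux ▸ Finset.mem_coe.2 (hS hu))
    · exact hu
    · exact hu
  · intro hu
    refine ⟨Or.inr hu, ?_⟩
    rcases Finset.mem_insert.1 (hT hu) with rfl | huB
    · exact Or.inr rfl
    · exact Or.inl huB

omit [Fintype V] [Fintype E] [DecidableEq E] in
/-- **The fibre of the cut vertex factors**: for `S ⊆ VA` and `x ∈ T ⊆ VB ∪ {x}`,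
`{C(x) = S ∪ T} = {C_A(x) = insert x S} ∩ {C_B(x) = T}`. -/
lemma clusterEvent_x_eq (h : IsCut ends x ↑VA ↑VB EA EB) {S : Finset V} (hS : S ⊆ VA)
    {T : Finset V} (hT : T ⊆ insert x VB) (hxT : x ∈ T) :
    clusterEvent ends x (↑(S ∪ T) : Set V) =
      sideEvent EA (clusterEvent ends x (↑(insert x S) : Set V)) ∩
        sideEvent EB (clusterEvent ends x (↑T : Set V)) := by
  ext ω
  simp only [Set.mem_inter_iff, mem_sideEvent, mem_clusterEvent]
  constructor
  · intro hW
    exact ⟨clusterA_x_eq h hS hT hxT hW, clusterB_x_eq h hS hT hxT hW⟩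
  · rintro ⟨hA, hB⟩
    rw [cluster_x_eq_union h, hA, hB, Finset.coe_insert, Finset.coe_union]
    ext u
    simp only [Set.mem_union, Set.mem_insert_iff, Finset.mem_coe]
    constructor
    · rintro ((rfl | hu) | hu)
      · exact Or.inr hxT
      · exact Or.inl hu
      · exact Or.inr hu
    · rintro (hu | hu)
      · exact Or.inl (Or.inr hu)
      · exact Or.inr hu

omit [Fintype V] [DecidableEq V] [Fintype E] [DecidableEq E] in
/-- A fibre of `x` at a set not containing `x` is empty. -/
lemma clusterEvent_x_eq_empty_of_notMem {W : Finset V} (hW : x ∉ W) :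
    clusterEvent ends x (↑W : Set V) = ∅ := by
  ext ω
  simp only [mem_clusterEvent, Set.mem_empty_iff_false, iff_false]
  intro hc
  apply hW
  have := mem_cluster_self ends ω x
  rw [hc] at this
  exact Finset.mem_coe.1 this

omit [Fintype V] [Fintype E] [DecidableEq E] [DecidablePred (· ∈ EA)] [DecidablePred (· ∈ EB)] in
/-- A fibre of `x` at a set not inside `VA ∪ VB ∪ {x}` is empty. -/
lemma clusterEvent_x_eq_empty_of_not_subset (h : IsCut ends x ↑VA ↑VB EA EB) {W : Finset V}
    (hW : ¬ W ⊆ VA ∪ insert x VB) : clusterEvent ends x (↑W : Set V) = ∅ := by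
  ext ω
  simp only [mem_clusterEvent, Set.mem_empty_iff_false, iff_false]
  intro hc
  apply hW
  intro u hu
  have hu' : u ∈ cluster ends ω x := by rw [hc]; exact Finset.mem_coe.2 hu
  rcases cluster_x_subset h ω hu' with (huA | huB) | hux
  · exact Finset.mem_union_left _ (Finset.mem_coe.1 huA)
  · exact Finset.mem_union_right _ (Finset.mem_insert_of_mem (Finset.mem_coe.1 huB))
  · rw [Set.mem_singleton_iff] at hux
    exact Finset.mem_union_right _ (hux ▸ Finset.mem_insert_self x VB)

omit [Fintype V] [DecidableEq V] [Fintype E] [DecidableEq E] in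
/-- Side events intersect inside the side. -/
lemma sideEvent_inter (F : Set E) [DecidablePred (· ∈ F)] (A B : Set (Config E)) :
    sideEvent F A ∩ sideEvent F B = sideEvent F (A ∩ B) := rfl

omit [Fintype V] [DecidableEq V] [Fintype E] [DecidableEq E] [DecidablePred (· ∈ EA)] in
/-- `Q` is a `B`-side event when both roots are on the `B`-side. -/
lemma avoidAll_eq_sideEventB (h : IsCut ends x ↑VA ↑VB EA EB) {a₁ a₂ : V} (h1 : a₁ ∈ VB)
    (h2 : a₂ ∈ VB) : avoidAll ends a₂ {a₁} = sideEvent EB (avoidAll ends a₂ {a₁}) := by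
  ext ω
  simp only [mem_sideEvent, mem_avoidAll, Finset.mem_singleton, forall_eq]
  exact not_congr (conn_iff_restrict h.symm (Or.inl (Finset.mem_coe.2 h2)) (Or.inl (Finset.mem_coe.2 h1)))

omit [Fintype V] [DecidableEq V] [Fintype E] [DecidableEq E] [DecidablePred (· ∈ EA)] in
/-- A connection event between `B`-side vertices is a `B`-side event. -/
lemma connEvent_eq_sideEventB (h : IsCut ends x ↑VA ↑VB EA EB) {u w : V} (hu : u ∈ VB)
    (hw : w ∈ VB) : connEvent ends u w = sideEvent EB (connEvent ends u w) :=
  connEvent_eq_sideEvent h.symm (Or.inl (Finset.mem_coe.2 hu)) (Or.inl (Finset.mem_coe.2 hw))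

variable {R : Type*} [CommRing R]

omit [Fintype V] in
/-- **Product law for the fibres of the cut vertex**: for `S ⊆ VA`, `x ∈ T ⊆ VB ∪ {x}`, an `A`-side
event `Z` and a `B`-side event `Y`,
`P({C(x) = S ∪ T} ∩ Z ∩ Y) = P({C_A(x) = insert x S} ∩ Z) · P({C_B(x) = T} ∩ Y)`. -/
lemma prob_clusterEvent_x_inter_eq_mul (p : E → R) (h : IsCut ends x ↑VA ↑VB EA EB)
    {S : Finset V} (hS : S ⊆ VA) {T : Finset V} (hT : T ⊆ insert x VB) (hxT : x ∈ T)
    (Z Y : Set (Config E)) :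
    prob p (clusterEvent ends x (↑(S ∪ T) : Set V) ∩ sideEvent EA Z ∩ sideEvent EB Y) =
      prob p (sideEvent EA (clusterEvent ends x (↑(insert x S) : Set V) ∩ Z)) *
        prob p (sideEvent EB (clusterEvent ends x (↑T : Set V) ∩ Y)) := by
  rw [clusterEvent_x_eq h hS hT hxT, ← sideEvent_inter, ← sideEvent_inter]
  rw [show sideEvent EA (clusterEvent ends x ↑(insert x S)) ∩ sideEvent EB (clusterEvent ends x ↑T) ∩
      sideEvent EA Z ∩ sideEvent EB Y =
      (sideEvent EA (clusterEvent ends x ↑(insert x S)) ∩ sideEvent EA Z) ∩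
        (sideEvent EB (clusterEvent ends x ↑T) ∩ sideEvent EB Y) by
    ext ω; simp only [Set.mem_inter_iff]; tauto]
  rw [sideEvent_inter, sideEvent_inter]
  exact prob_sideEvent_inter_eq_mul p h _ _

/-! ## The `A`-side cluster events partition every `A`-side event -/

omit [Fintype V] [Fintype E] [DecidableEq E] [DecidablePred (· ∈ EB)] in
/-- The `A`-side cluster of `x` is `insert x S` with `S ⊆ VA` not containing `x`. -/
lemma clusterA_x_mem_image (h : IsCut ends x ↑VA ↑VB EA EB) (ω : Config E) {W : Finset V}
    (hW : cluster ends (restrict EA ω) x = ↑W) : W ∈ VA.powerset.image (insert x) := by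
  rw [Finset.mem_image]
  refine ⟨W.erase x, Finset.mem_powerset.2 ?_, ?_⟩
  · intro u hu
    have hu' : u ∈ cluster ends (restrict EA ω) x := by
      rw [hW]; exact Finset.mem_coe.2 (Finset.mem_of_mem_erase hu)
    rcases cluster_restrict_subset h (Or.inr rfl) hu' with huA | hux
    · exact Finset.mem_coe.1 huA
    · exact absurd hux (Finset.ne_of_mem_erase hu)
  · apply Finset.insert_erase
    have := mem_cluster_self ends (restrict EA ω) x
    rw [hW] at this
    exact Finset.mem_coe.1 this

omit [DecidablePred (· ∈ EB)] in
/-- **Partition**: the `A`-side cluster events `{C_A(x) = insert x S}`, `S ⊆ VA`, partition every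
`A`-side event `Z`. -/
lemma sum_prob_sideA_cluster_inter (p : E → R) (h : IsCut ends x ↑VA ↑VB EA EB)
    (Z : Set (Config E)) :
    ∑ S ∈ VA.powerset, prob p (sideEvent EA (clusterEvent ends x (↑(insert x S) : Set V) ∩ Z)) =
      prob p (sideEvent EA Z) := by
  have hinj : Set.InjOn (fun S : Finset V => insert x S) (↑(VA.powerset) : Set (Finset V)) := by
    intro S hS S' hS' heq
    simp only [Finset.coe_powerset, Set.mem_preimage] at hS hS'
    have hxS : x ∉ S := fun hx => h.x_notA (Finset.mem_coe.2 (hS hx))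
    have hxS' : x ∉ S' := fun hx => h.x_notA (Finset.mem_coe.2 (hS' hx))
    have heq' : insert x S = insert x S' := heq
    rw [← Finset.erase_insert hxS, ← Finset.erase_insert hxS', heq']
  rw [show ∑ S ∈ VA.powerset, prob p (sideEvent EA (clusterEvent ends x (↑(insert x S) : Set V) ∩ Z)) =
      ∑ W ∈ VA.powerset.image (fun S => insert x S),
        prob p (sideEvent EA (clusterEvent ends x (↑W : Set V) ∩ Z)) from
      (Finset.sum_image (f := fun W : Finset V => prob p (sideEvent EA (clusterEvent ends x (↑W : Set V) ∩ Z)))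
        (s := VA.powerset) (g := fun S => insert x S) hinj).symm]
  rw [Finset.sum_subset (Finset.subset_univ _)]
  · unfold prob
    rw [Finset.sum_comm]
    refine Finset.sum_congr rfl fun ω _ => ?_
    by_cases hZ : ω ∈ sideEvent EA Z
    · have key : ∀ W : Finset V,
          (sideEvent EA (clusterEvent ends x (↑W : Set V) ∩ Z)).indicator (weight p) ω =
            (clusterEvent ends x (↑W : Set V)).indicator (fun _ => weight p ω) (restrict EA ω) := by
        intro W
        by_cases hW : restrict EA ω ∈ clusterEvent ends x (↑W : Set V)
        · rw [Set.indicator_of_mem hW, Set.indicator_of_mem]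
          exact ⟨hW, hZ⟩
        · rw [Set.indicator_of_notMem hW, Set.indicator_of_notMem]
          intro hc; exact hW hc.1
      simp_rw [key]
      rw [sum_indicator_clusterEvent, Set.indicator_of_mem hZ]
    · rw [Set.indicator_of_notMem hZ]
      refine Finset.sum_eq_zero fun W _ => ?_
      rw [Set.indicator_of_notMem]
      intro hc; exact hZ hc.2
  · intro W _ hW
    unfold prob
    refine Finset.sum_eq_zero fun ω _ => ?_
    rw [Set.indicator_of_notMem]
    intro hc
    exact hW (clusterA_x_mem_image h ω hc.1)

end CutVertex

end A3Fibre

end CovForm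

end Summit.Ventures.PercRepro2
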